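import Summits.HodgeConjecture.HodgeCM.PerL34.NormOneRelTorus_1

/-! PORT of `HodgeCM/PerL34/NormOneRelTorus.lean` (HodgeCMPerL run 82) — part 2: continuation of `Summits.HodgeConjecture.HodgeCM.PerL34.NormOneRelTorus_1` (split at a top-level declaration boundary by port_pkg.py; scope re-opened below; declarations unchanged). -/

-- port_pkg: scope re-opened for this part (file-level context, then the namespace/section stack open at the cut)
set_option autoImplicit false
noncomputable section
open Topology Filter Set Function MeasureTheory
open scoped Pointwise NNReal
namespace NumberField
open IsDedekindDomain
open Literature.NumberTheory Literature.NumberTheory.Automorphic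
/-- **The genuine torus datum of route (E)**: `A := U(1)_{L/K}(𝔸_K)`, `rat := L^1`, `ν := Haar` — every instance
field found by Lean from § 2 (no hypothesis). -/
def relNormOneTorusDatum (K L : Type) [Field K] [Field L] [NumberField L] [Algebra K L] [FiniteDimensional K L] :
    AutomorphicTorusDatum where
  A := relNormOneIdeles K L
  rat := relNormOneRat K L
  ν := haarRelNormOneQuot K L

/-! ## § 4. The CM case `K = L⁺`: `U(W_j) = U(1)_{L/L⁺}`, `N y = y · ȳ` -/

section CM

variable (L : Type) [Field L] [NumberField L] [IsCMField L]

/-- (Ported verbatim from the HodgeCMPerL package; no docstring in the source.) -/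
instance finiteDimensional_maximalRealSubfield : FiniteDimensional (maximalRealSubfield L) L :=
  Module.Finite.of_restrictScalars_finite ℚ (maximalRealSubfield L) L

open scoped Classical in
/-- `Aut(L/L⁺) = {1, c}`, `c` = complex conjugation. -/
theorem univ_eq_pair_complexConj :
    (Finset.univ : Finset (L ≃ₐ[maximalRealSubfield L] L)) = {1, IsCMField.complexConj L} := by
  symm
  apply Finset.eq_univ_of_card
  rw [Finset.card_pair (IsCMField.complexConj_ne_one L).symm, ← Nat.card_eq_fintype_card,
    IsGalois.card_aut_eq_finrank, Algebra.IsQuadraticExtension.finrank_eq_two (maximalRealSubfield L) L]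

/-- For a CM field, the Galois norm of an idele is `N y = y · ȳ`. -/
theorem ideleGalNorm_eq_mul_conj (y : ideleGroup L) :
    AdeleRing.ideleGalNorm (maximalRealSubfield L) L y = y * IsCMField.complexConj L • y := by
  classical
  rw [AdeleRing.ideleGalNorm_apply, univ_eq_pair_complexConj,
    Finset.prod_pair (IsCMField.complexConj_ne_one L).symm, one_smul]

/-- **`U(1)(𝔸_{L⁺}) = {y ∈ 𝔸_L^× : y ȳ = 1}`** — membership in the torus of a CM field is the unitarity relation of
PerL's hermitian line. -/
theorem mem_relNormOneIdeles_iff_mul_conj (y : ideleGroup L) :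
    y ∈ relNormOneIdeles (maximalRealSubfield L) L ↔ y * IsCMField.complexConj L • y = 1 := by
  rw [mem_relNormOneIdeles_iff, ideleGalNorm_eq_mul_conj]

/-- **The torus datum `[U(W_j)]` of a CM field `L`** (`W_j` a hermitian line over `L/L⁺`): the group / measure block of
`SupplyBridgeA` for the genuine `U(W_j)(𝔸) ⊇ U(W_j)(L⁺)`, constructed. -/
def unitaryLineTorusDatum : AutomorphicTorusDatum := relNormOneTorusDatum (maximalRealSubfield L) L

end CM

end NumberField

end
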